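import Summits.CriticalPhenomena.PercolationContinuityZ3.Theses.PercNonProliferation
import Summits.CriticalPhenomena.PercolationContinuityZ3.Theses.PercBudgetLadder
import Summits.CriticalPhenomena.PercolationContinuityZ3.Theorems.PercNonProliferationNonProliferationRatioDichotomy
import Summits.CriticalPhenomena.PercolationContinuityZ3.Theorems.PercNonProliferationAssembly
import Summits.CriticalPhenomena.PercolationContinuityZ3.Theorems.PercNonProliferationSpanningPiecesCount
import Summits.CriticalPhenomena.PercolationContinuityZ3.Theorems.PercNonProliferationDensityWhp
import HarnessLib

/-!
# Crux `PercNonProliferation.NonProliferation` (stmt-CriticalPhenomena-4444) — the JUMP / CONTINUOUS split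

Crux-strategist (wall-breaker, gen 1) decomposition file for the crux of route `PercNonProliferation`,
landed by lead c8 of line `jump-fragmentation` with `--supports stmt-CriticalPhenomena-4444`; closes nothing
by itself. It is the PROVED glue of the prepared split
`JumpNonProliferation → ContSureNonProliferation → NonProliferation` (to be filed by a planner with
`ledger route edit route-CriticalPhenomena-PercNonProliferation --split NonProliferation --glue-by
 Summit.CriticalPhenomena.PercolationContinuityZ3.Theorems.NonProliferation.nonProliferation_of_jump_of_contSure`),
plus three certificates recorded with it. No new definitions: the two sub-crux statements are spelled out
verbatim as hypotheses (their `def`s will be the gate-written items of the route file).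

## Why this split
Every line filed on the crux (boundary-pinning, birth-merge-ledger, avoidance-cost-covering; seven leads, two
triage rounds) died on one wall: a sufficient input for the UNCONDITIONAL crux must fail in `d ≥ 7`
(`Negative.nonProliferation_false_without_dimThree`), i.e. it must be a hyperscaling-side (`d ≤ 6`) fact — an
`a`-uniform multi-crosser bound at one aspect ratio — and no such fact is proved at `p_c(ℤ³)`.
But the route's deciding theorem consumes the crux ONLY inside the contradiction branch `θ(p_c) > 0`
(`Assembly`: jump ∧ FreeBoxSparse ∧ few spanning pieces ⇒ ⊥). The split separates the two logically
independent halves of the crux along exactly that case distinction and the landed ratio dichotomy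
(`crossing_tendsto_one_of_not_nonProliferation`: ¬crux ⇒ sure crossing at every fixed ratio):

* `JumpNonProliferation` — **the jump branch**: `0 < θ(p_c(ℤ³)) → NonProliferation`. It holds verbatim in every
  dimension where `θ(p_c) = 0` is a theorem (so the barrier `SpanningClustersAboveSix` does NOT bite it); it is a
  consequence of the summit (`jumpNonProliferation_of_continuity`) and, with the route's other hypothesis
  `FreeBoxSparse` and the three PROVED supports, it decides the summit (`continuity_of_freeBoxSparse_of_jump` —
  the route's `closes` re-glued on the jump branch alone). Its wall is sprinkling-free finite-volume uniqueness of
  the hypothetical critical infinite cluster (barrier `SprinklingRenormalisation`).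
* `ContSureNonProliferation` — **the continuous, sure-crossing residue**: `θ(p_c) = 0 →` (at every ratio `k ≥ 2`,
  `P_{p_c}(B(m) ↔ ∂ⁱⁿB(km) in B(km)) → 1`) `→ NonProliferation`. This is the crux's whole hyperscaling content
  (in `d ≥ 7` under (t-c) both hypotheses hold and the conclusion fails), it is NOT consumed by the route's
  `closes`, and it is VACUOUSLY implied by the target `PercBudgetLadder.CritAnnulusBlockedIO` (stmt-5247)
  (`contSureNonProliferation_of_critAnnulusBlockedIO`). Recommendation filed with the split: park it behind 5247.

Glue: by cases on `θ(p_c) = 0`; in the continuous case, if the crux failed, the dichotomy gives sure crossing at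
every ratio and the residue returns the crux.
-/

noncomputable section

namespace Summit.CriticalPhenomena.PercolationContinuityZ3.Theorems.NonProliferation

open MeasureTheory Filter Topology
open Literature.Probability.LatticeModels Literature.Probability.Percolation
open Summit.CriticalPhenomena.PercolationContinuityZ3.Theses.PercNonProliferation

/-- `θ(p_c(ℤ³)) ≥ 0` (a `Measure.real` value). [folklore] -/
theorem theta_criticalProbI_three_nonneg : 0 ≤ theta (zdGraph 3) (0 : Site 3) (criticalProbI 3) := by
  unfold theta
  exact measureReal_nonneg

/-- **GLUE of the split** `JumpNonProliferation → ContSureNonProliferation → NonProliferation` (the two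
sub-crux statements spelled out verbatim as the hypotheses `hJ`, `hC`). Cases on `θ(p_c) = 0`; in the
continuous case argue by contradiction through the landed ratio dichotomy
`crossing_tendsto_one_of_not_nonProliferation` (¬crux ⇒ sure crossing at every ratio `k ≥ 2`). -/
theorem nonProliferation_of_jump_of_contSure :
    (0 < theta (zdGraph 3) (0 : Site 3) (criticalProbI 3) →
      Summit.CriticalPhenomena.PercolationContinuityZ3.Theses.PercNonProliferation.NonProliferation) →
    (theta (zdGraph 3) (0 : Site 3) (criticalProbI 3) = 0 →
      (∀ k : ℕ, 2 ≤ k → Tendsto (fun m : ℕ => (bondPercolation (zdGraph 3) (criticalProbI 3)).real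
        {ω | ∃ x ∈ box 3 m, ∃ y ∈ innerBoundary (zdGraph 3) (box 3 (k * m)),
          ω ∈ openConnIn (↑(box 3 (k * m)) : Set (Site 3)) x y}) atTop (𝓝 1)) →
      Summit.CriticalPhenomena.PercolationContinuityZ3.Theses.PercNonProliferation.NonProliferation) →
    Summit.CriticalPhenomena.PercolationContinuityZ3.Theses.PercNonProliferation.NonProliferation := by
  intro hJ hC
  by_cases h0 : theta (zdGraph 3) (0 : Site 3) (criticalProbI 3) = 0
  · by_contra hNP
    exact hNP (hC h0 (fun k hk => crossing_tendsto_one_of_not_nonProliferation hNP hk))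
  · exact hJ (lt_of_le_of_ne theta_criticalProbI_three_nonneg (Ne.symm h0))

/-! ### Certificates recorded with the split -/

/-- **The residue is dominated by the target of route `PercBudgetLadder` (stmt-CriticalPhenomena-5247):**
`CritAnnulusBlockedIO → ContSureNonProliferation`, vacuously — blocking of `B(m) → ∂ⁱⁿB(l m)` with
probability `≥ c > 0` for infinitely many `m` at one ratio `l ≥ 2` is incompatible with sure crossing at
ratio `l`. So the residue closes for free the day 5247 closes, and nothing in it is needed by this route's
`closes` (next theorem but one). -/
theorem contSureNonProliferation_of_critAnnulusBlockedIO
    (h : Summit.CriticalPhenomena.PercolationContinuityZ3.Theses.PercBudgetLadder.CritAnnulusBlockedIO) :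
    Literature.Probability.Percolation.theta (Literature.Probability.LatticeModels.zdGraph 3) 0 (Literature.Probability.Percolation.criticalProbI 3) = 0 → (∀ k : ℕ, 2 ≤ k → Filter.Tendsto (fun m : ℕ => (Literature.Probability.Percolation.bondPercolation (Literature.Probability.LatticeModels.zdGraph 3) (Literature.Probability.Percolation.criticalProbI 3)).real {ω | ∃ x ∈ Literature.Probability.LatticeModels.box 3 m, ∃ y ∈ Literature.Probability.LatticeModels.innerBoundary (Literature.Probability.LatticeModels.zdGraph 3) (Literature.Probability.LatticeModels.box 3 (k * m)), ω ∈ Literature.Probability.Percolation.openConnIn ↑(Literature.Probability.LatticeModels.box 3 (k * m)) x y}) Filter.atTop (nhds 1)) → Summit.CriticalPhenomena.PercolationContinuityZ3.Theses.PercNonProliferation.NonProliferation := by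
  intro _ hsure
  obtain ⟨l, c, hl, hc, hio⟩ := h
  exfalso
  set μ : Measure (BondConfig (Site 3)) := bondPercolation (zdGraph 3) (criticalProbI 3) with hμ
  -- sure crossing at ratio `l`: eventually the crossing probability exceeds `1 - c`
  have hev := (tendsto_order.1 (hsure l hl)).1 (1 - c) (by linarith)
  obtain ⟨N, hN⟩ := eventually_atTop.1 hev
  obtain ⟨n, hNn, hblock⟩ := hio N
  have hlt := hN n hNn
  -- the blocked event is the complement of the crossing event
  have hcompl : μ.real {ω | ¬ ∃ x ∈ box 3 n, ∃ y ∈ innerBoundary (zdGraph 3) (box 3 (l * n)),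
        ω ∈ openConnIn (↑(box 3 (l * n)) : Set (Site 3)) x y} =
      1 - μ.real {ω | ∃ x ∈ box 3 n, ∃ y ∈ innerBoundary (zdGraph 3) (box 3 (l * n)),
        ω ∈ openConnIn (↑(box 3 (l * n)) : Set (Site 3)) x y} := by
    rw [show {ω : BondConfig (Site 3) | ¬ ∃ x ∈ box 3 n, ∃ y ∈ innerBoundary (zdGraph 3) (box 3 (l * n)),
          ω ∈ openConnIn (↑(box 3 (l * n)) : Set (Site 3)) x y} =
        {ω : BondConfig (Site 3) | ∃ x ∈ box 3 n, ∃ y ∈ innerBoundary (zdGraph 3) (box 3 (l * n)),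
          ω ∈ openConnIn (↑(box 3 (l * n)) : Set (Site 3)) x y}ᶜ from rfl]
    exact probReal_compl_eq_one_sub (RatioDichotomy.measurableSet_crossing 3 n (l * n))
  have hblock' : c ≤ 1 - μ.real {ω | ∃ x ∈ box 3 n, ∃ y ∈ innerBoundary (zdGraph 3) (box 3 (l * n)),
        ω ∈ openConnIn (↑(box 3 (l * n)) : Set (Site 3)) x y} := by
    rw [← hcompl]; exact hblock
  linarith

/-- **The jump branch is a consequence of the summit** (vacuously): `θ(p_c(ℤ³)) = 0 → JumpNonProliferation`. -/
theorem jumpNonProliferation_of_continuity (h : _root_.PercolationContinuityZ3) :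
    0 < Literature.Probability.Percolation.theta (Literature.Probability.LatticeModels.zdGraph 3) 0 (Literature.Probability.Percolation.criticalProbI 3) → Summit.CriticalPhenomena.PercolationContinuityZ3.Theses.PercNonProliferation.NonProliferation := by
  intro hpos
  exfalso
  have h0 : theta (zdGraph 3) (0 : Site 3) (criticalProbI 3) = 0 :=
    Literature.Probability.Percolation.percolationContinuityZ3_iff.1 h
  rw [h0] at hpos
  exact lt_irrefl _ hpos

/-- **The route decides the summit from the jump branch alone:** with the three PROVED supports
(`spanningPiecesCount_proof`, `densityWhp_proof`, `nonProlifAssembly_proof`) the route's `closes` re-glues as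
`FreeBoxSparse → JumpNonProliferation → θ(p_c(ℤ³)) = 0`; the residue `ContSureNonProliferation` is not
load-bearing for the route. -/
theorem continuity_of_freeBoxSparse_of_jump (hSparse : FreeBoxSparse)
    (hJ : 0 < Literature.Probability.Percolation.theta (Literature.Probability.LatticeModels.zdGraph 3) 0 (Literature.Probability.Percolation.criticalProbI 3) → Summit.CriticalPhenomena.PercolationContinuityZ3.Theses.PercNonProliferation.NonProliferation) :
    _root_.PercolationContinuityZ3 := by
  by_cases h0 : theta (zdGraph 3) (0 : Site 3) (criticalProbI 3) = 0
  · exact Literature.Probability.Percolation.percolationContinuityZ3_iff.2 h0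
  · exact Summit.CriticalPhenomena.PercolationContinuityZ3.Theorems.nonProlifAssembly_proof
      Summit.CriticalPhenomena.PercolationContinuityZ3.Theorems.spanningPiecesCount_proof
      Summit.CriticalPhenomena.PercolationContinuityZ3.Theorems.densityWhp_proof hSparse
      (hJ (lt_of_le_of_ne theta_criticalProbI_three_nonneg (Ne.symm h0)))

end Summit.CriticalPhenomena.PercolationContinuityZ3.Theorems.NonProliferation

end
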